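import Summits.QuantumAdvantage.AdviceFreeQNC0.GatedLocal37
import Summits.QuantumAdvantage.AdviceFreeQNC0.BlockCombGates37
import HarnessLib

/-!
# Cell qa-qnc0 — the gated-local rungs `GatedLocalHardU k` / `SectionLocalHardU k` PROVED for every `k`

Planner qa-qnc0-p1 g36 typed the rung `AffBells37G.GatedLocalHardU k` (gated-local strategies: `k` global MOD₃ gates of the
letters select a `(log₂ n)^C`-window-local walk strategy) and its section form `SectionLocalHardU k` (`GatedLocal37.lean`,
ROUND-35 §4.10 (5)), and proved the FREE-WINDOW case (gate forms vanishing on a long stretch).  Planner qa-qnc0-p1 g37's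
block-comb theorem **`BlockFibre37.gatesHardConst : GatesHardConst`** (`BlockCombGates37.lean`, landed by qn-prover-3 g21)
is exactly the dense case too: any constant number `k` of gates (`gateSum = gateVal` definitionally), any selector
`f : (𝔽₃)^k → T`, window-local branches — one `θ < 1` for all `k, C`.  This file records the two one-line consequences:

* `sectionLocalHardU (k) : SectionLocalHardU k` (section identity `card_wins_gated` + `gatesHardConst` with `f = id`);
* `gatedLocalHardU (k) : GatedLocalHardU k` (`gatedLocalHardU_of_section`).

WHAT THIS IS NOT: nothing beyond `gatesHardConst` (constant `k`; for `k ≲ log₃ n` gates see `gatesHardLog`); crux 22907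
untouched; no separation.
-/

noncomputable section

namespace Summit.QuantumAdvantage.AdviceFreeQNC0.AffBells37G

open Classical
open Finset

/-- **`SectionLocalHardU k` — PROVED for every `k`**: window-local walk strategies cannot concentrate their wins on the
MOD₃ sections of `k` linear forms of the letters (sum over the `3^k` sections of the section-wins `≤ θ·2ⁿ`). -/
theorem sectionLocalHardU (k : ℕ) : SectionLocalHardU k := by
  obtain ⟨θ, hθ, H⟩ := BlockFibre37.gatesHardConst
  refine ⟨θ, hθ, fun C => ?_⟩
  obtain ⟨n₀, hn₀⟩ := H k C
  refine ⟨n₀, fun n hn c ℓ z hz => ?_⟩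
  rw [← card_wins_gated]
  exact hn₀ n hn ℓ c (Fin k → ZMod 3) id z hz

/-- **`GatedLocalHardU k` — PROVED for every `k`**: gated-local strategies (`k` global MOD₃ gates selecting a
`(log₂ n)^C`-window-local strategy) win the walk game, every charge, on at most `θ·2ⁿ` inputs, one `θ < 1` for all `C`. -/
theorem gatedLocalHardU (k : ℕ) : GatedLocalHardU k :=
  gatedLocalHardU_of_section k (sectionLocalHardU k)

end Summit.QuantumAdvantage.AdviceFreeQNC0.AffBells37G

end
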